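import Summits.CriticalPhenomena.PercolationContinuityZ3.Theses.PercBurnResprinkle
import Literature.Probability.Percolation.PercolationProofs
import Literature.Probability.Percolation.StaticRenormalizationBlocks
import HarnessLib

/-!
# Crux `PercBurnResprinkle.VacantReignition` (stmt-CriticalPhenomena-7203), line `strip-fresh-field-lss`:
# the engine `NoCagesFat` NEEDS the sibling crux `VacantSetPercolates` (stmt-CriticalPhenomena-7205)

Kill-chain lemma for the line's only open stub `stub_noCagesFat` (the ENGINE: Bernoulli(`ρ`)-robust
nearest-neighbour percolation, from block `0`, of the blocks `x ∈ ℤ³` whose window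
`(2L+1)x + B(blockR L k)` misses the burnt set `I_p(U) = {y | C_{ω_p(U)}(y) infinite}` of the slightly
supercritical environment `ω_p(U) = configOfLabels p U`, for every aspect parameter `k ≥ 1`, some
`ρ < 1`, arbitrarily large scales `L` and some `p > p_c`).  We prove

  `NoCagesFat ⟹ (∀ G : p_c < p_fin(G) in d = 3) ⟹ VacantSetPercolates (7205)`,

where `p_c < p_fin(G)` is Grimmett–Holroyd–Kozma's FATTENED strict inequality: for some `p > p_c`,
with positive `P_p`-probability the origin lies in an infinite cluster of the lattice edges both of
whose endpoints are at sup-distance `> G` from the infinite cluster (GHK prove it for `d ≥ 19`, and in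
the fattened/spread-out form of their Thm 5 under a one-arm hypothesis expected to fail in `d = 3`;
it is OPEN for `3 ≤ d ≤ 18`, cf. their §1).  Consequently a refutation of item 7205 (3-D cages of the
slightly supercritical infinite cluster) kills this line's engine, hence the line.

The argument (survey `NoCagesFat-SURVEY.md` §(a) A2, formalised here):
1. Apply the engine at `k = 1`, `L₀ = G`: get `ρ`, `L ≥ G`, `p > p_c` and positive
   `labelMeasure ⊗ labelMeasure`-probability of the dust-percolation event `D`.
2. `p < 1` (`lt_one_of_pos_blockEvent`): if `1 ≤ p` then almost surely every label is `≤ 1 ≤ p`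
   (`labelMeasure_exists_one_lt_eq_zero`), so `ω_p(U) = E(ℤ³)`, every vertex is burnt
   (`zdGraph_reachable`), block `0` is not vacant; but percolation of block `0` forces block `0` to be
   vacant (`root_of_infinite`) — so `D` is null, a contradiction.
3. DETERMINISTIC CORE (`infinite_openCluster_centres`): on `D`, let `K ∋ 0` be the infinite block
   cluster; its blocks are vacant; lattice-adjacent blocks `x ~ x ± eᵢ` have centres
   `c_x = (2L+1)x` and `c_x ± (2L+1)eᵢ` joined by the straight lattice segment of `2L+1` unit edges,
   all of whose vertices `c_x + j eᵢ + z`, `|z|_∞ ≤ G`, lie in the vacant window `c_x + B(blockR L 1)`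
   (`2L+1+G ≤ 6L+2`), so every segment edge is a lattice edge with both endpoints `G`-far from `I_p`
   (`reachable_segment`); induction along block walks (`reachable_lift`) puts every centre `c_x`,
   `x ∈ K`, in the fattened-vacant cluster of `c_0 = 0`, which is infinite because `x ↦ (2L+1)x` is
   injective.
4. MEASURE (`bondPercolation_real_pos_of_subset`): `D ⊆ Prod.fst ⁻¹' (ω_p ⁻¹' V)`; the first marginal
   of `labelMeasure ⊗ labelMeasure` is `labelMeasure` (`Measure.prod_prod`), the law of `ω_p` is `P_p`
   (`map_configOfLabels_holds`) and `labelMeasure (ω_p ⁻¹' V) ≤ P_p(V)` (`Measure.le_map_apply`, no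
   measurability of `V` needed), whence `P_p(V) > 0`.

References: G. R. Grimmett, A. E. Holroyd, G. Kozma, *Percolation of finite clusters and infinite
surfaces*, Math. Proc. Camb. Phil. Soc. 156 (2014), §1 (the question `p_c < p_fin` for
`3 ≤ d ≤ 18`) and Thm 5 (the fattened set `X^F`).  Design: pure theorem file, no definitions; the
block/segment combinatorics is stated for general dimension `d`, spacing `N` and abstract block and
vertex predicates; the hypothesis of the two final theorems is the registered text of
`stub_noCagesFat` verbatim, the conclusion of the first is the route item `VacantSetPercolates` by name.
-/

noncomputable section

namespace Summit.CriticalPhenomena.PercolationContinuityZ3.Theorems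

open MeasureTheory Set Literature.Probability.Percolation Literature.Probability.LatticeModels
open Summit.CriticalPhenomena.PercolationContinuityZ3.Theses.PercBurnResprinkle

/-! ## Walks in block graphs and along lattice segments -/

/-- Reachability is transported along any vertex map sending edges to joined pairs (induction on a
walk). [folklore] -/
private theorem reachable_lift {V W : Type*} {G : SimpleGraph V} {H : SimpleGraph W} (f : V → W)
    {a b : V} (p : G.Walk a b) (h : ∀ a b, G.Adj a b → H.Reachable (f a) (f b)) :
    H.Reachable (f a) (f b) := by
  induction p with
  | nil => exact SimpleGraph.Reachable.refl _
  | cons hadj _ ih => exact (h _ _ hadj).trans ih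

/-- An edge of the block graph is a lattice edge whose endpoints both satisfy the block predicate.
[folklore] -/
private theorem adj_blockGraph {V : Type*} {E₀ : Set (Sym2 V)} {P : V → Prop} {a b : V}
    (h : (openGraph {E : Sym2 V | E ∈ E₀ ∧ ∀ z ∈ E, P z}).Adj a b) : s(a, b) ∈ E₀ ∧ P a ∧ P b := by
  rw [openGraph_adj, Set.mem_setOf_eq] at h
  exact ⟨h.1.1, h.1.2 a (Sym2.mem_mk_left a b), h.1.2 b (Sym2.mem_mk_right a b)⟩

/-- The root of an infinite block cluster satisfies the block predicate. [folklore] -/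
private theorem root_of_infinite {V : Type*} {E₀ : Set (Sym2 V)} {P : V → Prop} {x : V}
    (hK : (openCluster {E : Sym2 V | E ∈ E₀ ∧ ∀ z ∈ E, P z} x).Infinite) : P x := by
  obtain ⟨a, ha, ha0⟩ := hK.exists_notMem_finset {x}
  rw [Finset.mem_singleton] at ha0
  obtain ⟨W⟩ := (ha : (openGraph _).Reachable x a)
  cases W with
  | nil => exact absurd rfl ha0
  | cons hadj _ => exact (adj_blockGraph hadj).2.1

/-- Every vertex of a block cluster whose root satisfies the block predicate satisfies it. [folklore] -/
private theorem pred_of_mem_openCluster {V : Type*} {E₀ : Set (Sym2 V)} {P : V → Prop} {x : V}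
    (hx : P x) {y : V} (hy : y ∈ openCluster {E : Sym2 V | E ∈ E₀ ∧ ∀ z ∈ E, P z} x) : P y := by
  obtain ⟨W⟩ := (hy : (openGraph _).Reachable x y).symm
  cases W with
  | nil => exact hx
  | cons hadj _ => exact (adj_blockGraph hadj).2.1

/-- **Straight segments of good vertices are paths of the good-edge graph.**  If the `n + 1` lattice
points `c, c + eᵢ, …, c + n eᵢ` are all good, then `c` and `c + n eᵢ` are joined in the graph of
lattice edges with two good endpoints (induction on `n`; each step `c + j eᵢ ~ c + (j+1) eᵢ` is a
lattice edge by `zdGraph_adj_iff`). [folklore] -/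
private theorem reachable_segment {d : ℕ} (good : Site d → Prop) (c : Site d) (i : Fin d) (n : ℕ)
    (h : ∀ j : ℕ, j ≤ n → good (c + Pi.single i (j : ℤ))) :
    (openGraph {e : Sym2 (Site d) | e ∈ (zdGraph d).edgeSet ∧ ∀ y ∈ e, good y}).Reachable
      c (c + Pi.single i (n : ℤ)) := by
  induction n with
  | zero =>
    rw [Nat.cast_zero, Pi.single_zero, add_zero]
  | succ n ih =>
    have hadj : (zdGraph d).Adj (c + Pi.single i (n : ℤ)) (c + Pi.single i ((n + 1 : ℕ) : ℤ)) := by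
      rw [zdGraph_adj_iff]
      refine ⟨i, Or.inl ?_⟩
      rw [add_assoc, ← Pi.single_add]
      push_cast
      rfl
    refine (ih fun j hj => h j (Nat.le_succ_of_le hj)).trans (SimpleGraph.Adj.reachable ?_)
    rw [openGraph_adj]
    refine ⟨⟨(SimpleGraph.mem_edgeSet _).2 hadj, fun y hy => ?_⟩, hadj.ne⟩
    rcases Sym2.mem_iff.1 hy with rfl | rfl
    · exact h n (Nat.le_succ n)
    · exact h (n + 1) le_rfl

/-- **Deterministic core (block percolation ⟹ lattice percolation of the centres).**  In `ℤ^d` with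
block spacing `N ≠ 0`: if block `0` lies in an infinite nearest-neighbour cluster of blocks satisfying
`P`, and for every `P`-block `x` all lattice points `N x + j eᵢ`, `0 ≤ j ≤ N`, of the `d` forward
segments issuing from its centre are good, then the centre `0` of block `0` lies in an infinite cluster
of the graph of lattice edges with two good endpoints: adjacent blocks `x ~ x ± eᵢ` have centres joined
by a good segment (`reachable_segment`, using the `P`-block among the two that owns the forward
segment), induction along block walks joins every centre `N x`, `x` in the block cluster, to `0`, and
`x ↦ N x` is injective. [folklore] -/
private theorem infinite_openCluster_centres {d : ℕ} (N : ℕ) (hN : N ≠ 0) (P good : Site d → Prop)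
    (hperc : (openCluster {E : Sym2 (Site d) | E ∈ (zdGraph d).edgeSet ∧ ∀ x ∈ E, P x}
      (0 : Site d)).Infinite)
    (hgood : ∀ x, P x → ∀ (i : Fin d) (j : ℕ), j ≤ N → good ((N : ℤ) • x + Pi.single i (j : ℤ))) :
    (openCluster {e : Sym2 (Site d) | e ∈ (zdGraph d).edgeSet ∧ ∀ y ∈ e, good y}
      (0 : Site d)).Infinite := by
  have h0 : P 0 := root_of_infinite hperc
  -- forward segments from the centre of a `P`-block
  have hseg : ∀ a : Site d, P a → ∀ i : Fin d,
      (openGraph {e : Sym2 (Site d) | e ∈ (zdGraph d).edgeSet ∧ ∀ y ∈ e, good y}).Reachable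
        ((N : ℤ) • a) ((N : ℤ) • (a + Pi.single i 1)) := by
    intro a ha i
    have e : (N : ℤ) • (a + Pi.single i 1) = (N : ℤ) • a + Pi.single i (N : ℤ) := by
      rw [smul_add]
      congr 1
      ext j
      by_cases hj : j = i
      · subst hj; simp
      · simp [hj]
    rw [e]
    exact reachable_segment good _ i N fun j hj => hgood a ha i j hj
  -- every block edge glues the two centres
  have hadj : ∀ a b, (openGraph {E : Sym2 (Site d) | E ∈ (zdGraph d).edgeSet ∧ ∀ x ∈ E, P x}).Adj a b →
      (openGraph {e : Sym2 (Site d) | e ∈ (zdGraph d).edgeSet ∧ ∀ y ∈ e, good y}).Reachable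
        ((N : ℤ) • a) ((N : ℤ) • b) := by
    intro a b h
    obtain ⟨hab, hPa, hPb⟩ := adj_blockGraph h
    rw [SimpleGraph.mem_edgeSet, zdGraph_adj_iff] at hab
    obtain ⟨i, hb | ha'⟩ := hab
    · rw [hb]; exact hseg a hPa i
    · rw [ha']; exact (hseg b hPb i).symm
  -- hence every centre of the block cluster of `0` is joined to the centre `0`
  have hreach : ∀ y ∈ openCluster {E : Sym2 (Site d) | E ∈ (zdGraph d).edgeSet ∧ ∀ x ∈ E, P x} (0 : Site d),
      (openGraph {e : Sym2 (Site d) | e ∈ (zdGraph d).edgeSet ∧ ∀ y ∈ e, good y}).Reachable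
        ((N : ℤ) • (0 : Site d)) ((N : ℤ) • y) := by
    intro y hy
    obtain ⟨W⟩ := (hy : (openGraph _).Reachable 0 y)
    exact reachable_lift (fun x => (N : ℤ) • x) W hadj
  -- the centre map is injective
  have hinj : Set.InjOn (fun x : Site d => (N : ℤ) • x)
      (openCluster {E : Sym2 (Site d) | E ∈ (zdGraph d).edgeSet ∧ ∀ x ∈ E, P x} (0 : Site d)) := by
    intro x _ x' _ heq
    have hN' : (N : ℤ) ≠ 0 := by exact_mod_cast hN
    exact smul_right_injective (Site d) hN' heq
  refine Set.infinite_of_injOn_mapsTo hinj (fun y hy => ?_) hperc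
  have h := hreach y hy
  rw [smul_zero] at h
  exact h

/-! ## The dust-percolation event of the engine forces (fattened) vacant-set percolation -/

/-- **Window vacancy of percolating blocks ⟹ the origin percolates in the `G`-fattened vacant set**
(pathwise, every scale `L`, aspect `k`, fattening `G` with `2L+1+G ≤ blockR L k`, levels `p, ρ`):
on the engine's event, the environment `ω_p(π.1)` lies in GHK's event "`0` is in an infinite cluster of
lattice edges whose endpoints `y` have `y + B(G)` disjoint from the infinite cluster".  The segment
points `(2L+1)x + j eᵢ + z`, `0 ≤ j ≤ 2L+1`, `z ∈ B(G)`, lie in the window `(2L+1)x + B(blockR L k)`.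
[cite: GrimmettHolroydKozma2014, §1 and Thm 5] -/
private theorem blockEvent_subset_preimage_fattened (L k G : ℕ) (hG : 2 * L + 1 + G ≤ blockR L k)
    (p ρ : ℝ) :
    {π : (Sym2 (Fin 3 → ℤ) → ℝ) × (Sym2 (Fin 3 → ℤ) → ℝ) |
        (openCluster {E : Sym2 (Fin 3 → ℤ) | E ∈ (zdGraph 3).edgeSet ∧ ∀ x ∈ E,
            (∀ y ∈ (↑(box 3 (blockR L k)) : Set (Fin 3 → ℤ)),
              ¬ (openCluster (configOfLabels p π.1 (zdGraph 3)) (((2 * L + 1 : ℕ) : ℤ) • x + y)).Infinite) ∧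
            π.2 (s(((2 * L + 1 : ℕ) : ℤ) • x, ((2 * L + 1 : ℕ) : ℤ) • x + Pi.single 0 1)) ≤ ρ}
          (0 : Fin 3 → ℤ)).Infinite} ⊆
      Prod.fst ⁻¹' ((fun U : Sym2 (Fin 3 → ℤ) → ℝ => configOfLabels p U (zdGraph 3)) ⁻¹'
        {ω | (openCluster {e | e ∈ (zdGraph 3).edgeSet ∧ ∀ y ∈ e,
          ∀ z ∈ (↑(box 3 G) : Set (Fin 3 → ℤ)), ¬ (openCluster ω (y + z)).Infinite}
            (0 : Fin 3 → ℤ)).Infinite}) := by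
  intro π hπ
  simp only [mem_preimage, mem_setOf_eq]
  refine infinite_openCluster_centres (2 * L + 1) (by omega) _ _ hπ fun x hx i j hj z hz => ?_
  rw [add_assoc]
  refine hx.1 _ (Finset.mem_coe.2 (mem_box.2 fun i' => ?_))
  have hz' := (mem_box.1 (Finset.mem_coe.1 hz)) i'
  rw [Pi.add_apply, Pi.single_apply]
  split_ifs <;> constructor <;> omega

/-- **Window vacancy of percolating blocks ⟹ the origin percolates in the vacant set** (pathwise,
every `L, k, p, ρ`; the case `G = 0` of the previous lemma, with the route's unfattened set-builder):
on the engine's event the environment `ω_p(π.1)` lies in the event of item 7205, "`0` is in an infinite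
cluster of lattice edges with no burnt endpoint".  [cite: GrimmettHolroydKozma2014, §1 and Thm 5] -/
private theorem blockEvent_subset_preimage (L k : ℕ) (p ρ : ℝ) :
    {π : (Sym2 (Fin 3 → ℤ) → ℝ) × (Sym2 (Fin 3 → ℤ) → ℝ) |
        (openCluster {E : Sym2 (Fin 3 → ℤ) | E ∈ (zdGraph 3).edgeSet ∧ ∀ x ∈ E,
            (∀ y ∈ (↑(box 3 (blockR L k)) : Set (Fin 3 → ℤ)),
              ¬ (openCluster (configOfLabels p π.1 (zdGraph 3)) (((2 * L + 1 : ℕ) : ℤ) • x + y)).Infinite) ∧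
            π.2 (s(((2 * L + 1 : ℕ) : ℤ) • x, ((2 * L + 1 : ℕ) : ℤ) • x + Pi.single 0 1)) ≤ ρ}
          (0 : Fin 3 → ℤ)).Infinite} ⊆
      Prod.fst ⁻¹' ((fun U : Sym2 (Fin 3 → ℤ) → ℝ => configOfLabels p U (zdGraph 3)) ⁻¹'
        {ω | (openCluster {e | e ∈ (zdGraph 3).edgeSet ∧ ∀ y ∈ e, ¬ (openCluster ω y).Infinite}
          (0 : Fin 3 → ℤ)).Infinite}) := by
  intro π hπ
  simp only [mem_preimage, mem_setOf_eq]
  have hR : 2 * L + 1 ≤ blockR L k := by unfold blockR; omega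
  refine infinite_openCluster_centres (2 * L + 1) (by omega) _ _ hπ fun x hx i j hj => ?_
  refine hx.1 _ (Finset.mem_coe.2 (mem_box.2 fun i' => ?_))
  rw [Pi.single_apply]
  split_ifs <;> constructor <;> omega

/-! ## Measure theory: `p < 1`, and transfer to `P_p` -/

/-- No label exceeds `1`: `labelMeasure {U | ∃ e, 1 < U e} = 0` (countable union of the null
coordinate events `{1 < U_e}`, `Measure.infinitePi_map_eval`). [folklore] -/
private theorem labelMeasure_exists_one_lt_eq_zero :
    labelMeasure (Fin 3 → ℤ) {U | ∃ e, 1 < U e} = 0 := by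
  have := isProbabilityMeasure_volume_restrict_unitInterval
  rw [show {U : Sym2 (Fin 3 → ℤ) → ℝ | ∃ e, 1 < U e} = ⋃ e, {U | U e ∈ Ioi 1} by ext U; simp]
  refine measure_iUnion_null fun e => ?_
  rw [show {U : Sym2 (Fin 3 → ℤ) → ℝ | U e ∈ Ioi 1} = (fun U : Sym2 (Fin 3 → ℤ) → ℝ => U e) ⁻¹' Ioi 1
      from rfl, ← Measure.map_apply (measurable_pi_apply e) measurableSet_Ioi, labelMeasure,
    Measure.infinitePi_map_eval, Measure.restrict_apply measurableSet_Ioi]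
  have : Ioi (1 : ℝ) ∩ Icc (0 : ℝ) 1 = ∅ := by
    ext x; simp only [mem_inter_iff, mem_Ioi, mem_Icc, mem_empty_iff_false, iff_false]
    rintro ⟨h1, -, h2⟩; linarith
  rw [this, measure_empty]

/-- **The engine's witness level is `< 1`.**  If the engine's event has positive
`labelMeasure ⊗ labelMeasure`-probability at level `p`, then `p < 1`: for `1 ≤ p`, off the null set
`{∃ e, 1 < U_e}` the environment is all of `E(ℤ³)`, every vertex is burnt (`zdGraph_reachable`), so the
centre `0` of block `0`'s window is burnt and block `0` is not vacant, while percolation from block `0`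
forces block `0` to be vacant (`root_of_infinite`). [folklore] -/
private theorem lt_one_of_pos_blockEvent {L k : ℕ} {p ρ : ℝ}
    (hpos : 0 < ((labelMeasure (Fin 3 → ℤ)).prod (labelMeasure (Fin 3 → ℤ))).real
      {π : (Sym2 (Fin 3 → ℤ) → ℝ) × (Sym2 (Fin 3 → ℤ) → ℝ) |
        (openCluster {E : Sym2 (Fin 3 → ℤ) | E ∈ (zdGraph 3).edgeSet ∧ ∀ x ∈ E,
            (∀ y ∈ (↑(box 3 (blockR L k)) : Set (Fin 3 → ℤ)),
              ¬ (openCluster (configOfLabels p π.1 (zdGraph 3)) (((2 * L + 1 : ℕ) : ℤ) • x + y)).Infinite) ∧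
            π.2 (s(((2 * L + 1 : ℕ) : ℤ) • x, ((2 * L + 1 : ℕ) : ℤ) • x + Pi.single 0 1)) ≤ ρ}
          (0 : Fin 3 → ℤ)).Infinite}) :
    p < 1 := by
  by_contra hle
  rw [not_lt] at hle
  have := isProbabilityMeasure_labelMeasure (Fin 3 → ℤ)
  haveI : Infinite (Fin 3 → ℤ) := Infinite.of_injective (fun n : ℤ => fun _ : Fin 3 => n)
    (fun a b h => by simpa using congrFun h 0)
  have hsub : {π : (Sym2 (Fin 3 → ℤ) → ℝ) × (Sym2 (Fin 3 → ℤ) → ℝ) |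
        (openCluster {E : Sym2 (Fin 3 → ℤ) | E ∈ (zdGraph 3).edgeSet ∧ ∀ x ∈ E,
            (∀ y ∈ (↑(box 3 (blockR L k)) : Set (Fin 3 → ℤ)),
              ¬ (openCluster (configOfLabels p π.1 (zdGraph 3)) (((2 * L + 1 : ℕ) : ℤ) • x + y)).Infinite) ∧
            π.2 (s(((2 * L + 1 : ℕ) : ℤ) • x, ((2 * L + 1 : ℕ) : ℤ) • x + Pi.single 0 1)) ≤ ρ}
          (0 : Fin 3 → ℤ)).Infinite} ⊆
      Prod.fst ⁻¹' {U : Sym2 (Fin 3 → ℤ) → ℝ | ∃ e, 1 < U e} := by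
    intro π hπ
    by_contra hU
    simp only [mem_preimage, mem_setOf_eq, not_exists, not_lt] at hU
    have h0 := (root_of_infinite hπ).1 0 (Finset.mem_coe.2 (mem_box.2 fun i => by simp))
    apply h0
    have hconf : configOfLabels p π.1 (zdGraph 3) = (zdGraph 3).edgeSet := by
      ext e; exact ⟨fun h => h.1, fun he => ⟨he, (hU e).trans hle⟩⟩
    have huniv : openCluster (configOfLabels p π.1 (zdGraph 3))
        (((2 * L + 1 : ℕ) : ℤ) • (0 : Fin 3 → ℤ) + 0) = univ := by
      ext z
      simp only [openCluster, hconf, openGraph, SimpleGraph.fromEdgeSet_edgeSet, mem_setOf_eq,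
        mem_univ, iff_true]
      exact zdGraph_reachable _ z
    rw [huniv]
    exact infinite_univ
  have hnull : (labelMeasure (Fin 3 → ℤ)).prod (labelMeasure (Fin 3 → ℤ))
      (Prod.fst ⁻¹' {U : Sym2 (Fin 3 → ℤ) → ℝ | ∃ e, 1 < U e}) = 0 := by
    rw [← prod_univ, Measure.prod_prod, measure_univ, mul_one]
    exact labelMeasure_exists_one_lt_eq_zero
  have h0 : ((labelMeasure (Fin 3 → ℤ)).prod (labelMeasure (Fin 3 → ℤ))).real
      {π : (Sym2 (Fin 3 → ℤ) → ℝ) × (Sym2 (Fin 3 → ℤ) → ℝ) |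
        (openCluster {E : Sym2 (Fin 3 → ℤ) | E ∈ (zdGraph 3).edgeSet ∧ ∀ x ∈ E,
            (∀ y ∈ (↑(box 3 (blockR L k)) : Set (Fin 3 → ℤ)),
              ¬ (openCluster (configOfLabels p π.1 (zdGraph 3)) (((2 * L + 1 : ℕ) : ℤ) • x + y)).Infinite) ∧
            π.2 (s(((2 * L + 1 : ℕ) : ℤ) • x, ((2 * L + 1 : ℕ) : ℤ) • x + Pi.single 0 1)) ≤ ρ}
          (0 : Fin 3 → ℤ)).Infinite} = 0 := by
    rw [measureReal_def, measure_mono_null hsub hnull, ENNReal.toReal_zero]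
  linarith

/-- **Transfer to `P_p`.**  If an event `D` of label pairs of positive `labelMeasure ⊗ labelMeasure`-
probability is contained in `{π | ω_p(π.1) ∈ V}`, `p ∈ [0,1]`, then `P_p(V) > 0`: the first marginal
of the product is `labelMeasure` (`Measure.prod_prod`), whose image under `ω_p = configOfLabels p` is
`P_p` (`map_configOfLabels_holds`), and `labelMeasure (ω_p ⁻¹' V) ≤ (map ω_p labelMeasure) V`
(`Measure.le_map_apply`; no measurability of `V` is needed). [folklore] -/
private theorem bondPercolation_real_pos_of_subset (p : unitInterval)
    {D : Set ((Sym2 (Fin 3 → ℤ) → ℝ) × (Sym2 (Fin 3 → ℤ) → ℝ))} {V : Set (BondConfig (Fin 3 → ℤ))}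
    (hDV : D ⊆ Prod.fst ⁻¹' ((fun U : Sym2 (Fin 3 → ℤ) → ℝ => configOfLabels (p : ℝ) U (zdGraph 3)) ⁻¹' V))
    (hpos : 0 < ((labelMeasure (Fin 3 → ℤ)).prod (labelMeasure (Fin 3 → ℤ))).real D) :
    0 < (bondPercolation (zdGraph 3) p).real V := by
  have := isProbabilityMeasure_labelMeasure (Fin 3 → ℤ)
  have hμ : (labelMeasure (Fin 3 → ℤ)).prod (labelMeasure (Fin 3 → ℤ))
      (Prod.fst ⁻¹' ((fun U : Sym2 (Fin 3 → ℤ) → ℝ => configOfLabels (p : ℝ) U (zdGraph 3)) ⁻¹' V))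
        ≠ 0 := by
    intro h0
    have : ((labelMeasure (Fin 3 → ℤ)).prod (labelMeasure (Fin 3 → ℤ))).real D = 0 := by
      rw [measureReal_def, measure_mono_null hDV h0, ENNReal.toReal_zero]
    linarith
  rw [← prod_univ, Measure.prod_prod, measure_univ, mul_one] at hμ
  have hle : labelMeasure (Fin 3 → ℤ)
      ((fun U : Sym2 (Fin 3 → ℤ) → ℝ => configOfLabels (p : ℝ) U (zdGraph 3)) ⁻¹' V) ≤
        bondPercolation (zdGraph 3) p V := by
    rw [← map_configOfLabels_holds (zdGraph 3) p]
    exact Measure.le_map_apply (measurable_configOfLabels _ _).aemeasurable _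
  have hne : bondPercolation (zdGraph 3) p V ≠ 0 :=
    fun h0 => hμ (le_antisymm (hle.trans h0.le) bot_le)
  exact ENNReal.toReal_pos hne (measure_ne_top _ _)

/-! ## The kill chain -/

/-- **`NoCagesFat ⟹ VacantSetPercolates` (the engine of line `strip-fresh-field-lss` of crux 7203
implies the sibling crux stmt-CriticalPhenomena-7205).**  Hypothesis: the registered text of
`stub_noCagesFat` verbatim.  Proof: apply it at `k = 1`, `L₀ = 0`; the witness level `p` is in
`(p_c, 1)` (`lt_one_of_pos_blockEvent`, `criticalProb_mem_Icc`); pathwise the event forces the origin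
to percolate in the vacant set of `ω_p(π.1)` (`blockEvent_subset_preimage`); transfer to `P_p`
(`bondPercolation_real_pos_of_subset`).  Hence 3-D cages for the slightly supercritical infinite
cluster (`¬ VacantSetPercolates`, i.e. `p_fin(3) = p_c(3)`, GHK's open question answered negatively)
would refute the engine. [cite: GrimmettHolroydKozma2014, §1 and Thm 5] -/
theorem noCagesFat_imp_vacantSetPercolates :
    (∀ k : ℕ, 1 ≤ k → ∃ ρ : ℝ, ρ < 1 ∧ ∀ L₀ : ℕ, ∃ L : ℕ, L₀ ≤ L ∧ ∃ p : ℝ,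
    criticalProb (zdGraph 3) (0 : Fin 3 → ℤ) < p ∧
    0 < ((labelMeasure (Fin 3 → ℤ)).prod (labelMeasure (Fin 3 → ℤ))).real
      {π : (Sym2 (Fin 3 → ℤ) → ℝ) × (Sym2 (Fin 3 → ℤ) → ℝ) |
        (openCluster {E : Sym2 (Fin 3 → ℤ) | E ∈ (zdGraph 3).edgeSet ∧ ∀ x ∈ E,
            (∀ y ∈ (↑(box 3 (blockR L k)) : Set (Fin 3 → ℤ)),
              ¬ (openCluster (configOfLabels p π.1 (zdGraph 3)) (((2 * L + 1 : ℕ) : ℤ) • x + y)).Infinite) ∧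
            π.2 (s(((2 * L + 1 : ℕ) : ℤ) • x, ((2 * L + 1 : ℕ) : ℤ) • x + Pi.single 0 1)) ≤ ρ}
          (0 : Fin 3 → ℤ)).Infinite}) →
    Summit.CriticalPhenomena.PercolationContinuityZ3.Theses.PercBurnResprinkle.VacantSetPercolates := by
  intro hNC
  obtain ⟨ρ, -, hρ⟩ := hNC 1 le_rfl
  obtain ⟨L, -, p, hp, hpos⟩ := hρ 0
  have hp1 : p < 1 := lt_one_of_pos_blockEvent hpos
  have hp0 : 0 ≤ p := (criticalProb_mem_Icc _ _).1.trans hp.le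
  exact ⟨⟨p, hp0, hp1.le⟩, hp,
    bondPercolation_real_pos_of_subset ⟨p, hp0, hp1.le⟩ (blockEvent_subset_preimage L 1 p ρ) hpos⟩

/-- **`NoCagesFat ⟹ ∀ G, p_c < p_fin(G)` in `d = 3` (Grimmett–Holroyd–Kozma's FATTENED strict
inequality, the conclusion shape of their Thm 5, open for `3 ≤ d ≤ 18`).**  For every fattening
radius `G` there is `p ∈ (p_c, 1)` at which, with positive `P_p`-probability, the origin lies in an
infinite cluster of lattice edges whose endpoints `y` have the whole box `y + B(G)` off the infinite
cluster.  Proof: the engine at `k = 1`, `L₀ = G` gives `L ≥ G`, so `2L+1+G ≤ blockR L 1 = 6L+2`, and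
`blockEvent_subset_preimage_fattened` applies; then as in `noCagesFat_imp_vacantSetPercolates`.
[cite: GrimmettHolroydKozma2014, §1 and Thm 5] -/
theorem noCagesFat_imp_fattened :
    (∀ k : ℕ, 1 ≤ k → ∃ ρ : ℝ, ρ < 1 ∧ ∀ L₀ : ℕ, ∃ L : ℕ, L₀ ≤ L ∧ ∃ p : ℝ,
    criticalProb (zdGraph 3) (0 : Fin 3 → ℤ) < p ∧
    0 < ((labelMeasure (Fin 3 → ℤ)).prod (labelMeasure (Fin 3 → ℤ))).real
      {π : (Sym2 (Fin 3 → ℤ) → ℝ) × (Sym2 (Fin 3 → ℤ) → ℝ) |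
        (openCluster {E : Sym2 (Fin 3 → ℤ) | E ∈ (zdGraph 3).edgeSet ∧ ∀ x ∈ E,
            (∀ y ∈ (↑(box 3 (blockR L k)) : Set (Fin 3 → ℤ)),
              ¬ (openCluster (configOfLabels p π.1 (zdGraph 3)) (((2 * L + 1 : ℕ) : ℤ) • x + y)).Infinite) ∧
            π.2 (s(((2 * L + 1 : ℕ) : ℤ) • x, ((2 * L + 1 : ℕ) : ℤ) • x + Pi.single 0 1)) ≤ ρ}
          (0 : Fin 3 → ℤ)).Infinite}) →
    ∀ G : ℕ, ∃ p : unitInterval, criticalProb (zdGraph 3) (0 : Fin 3 → ℤ) < (p : ℝ) ∧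
      0 < (bondPercolation (zdGraph 3) p).real
        {ω | (openCluster {e | e ∈ (zdGraph 3).edgeSet ∧ ∀ y ∈ e,
          ∀ z ∈ (↑(box 3 G) : Set (Fin 3 → ℤ)), ¬ (openCluster ω (y + z)).Infinite}
            (0 : Fin 3 → ℤ)).Infinite} := by
  intro hNC G
  obtain ⟨ρ, -, hρ⟩ := hNC 1 le_rfl
  obtain ⟨L, hL, p, hp, hpos⟩ := hρ G
  have hp1 : p < 1 := lt_one_of_pos_blockEvent hpos
  have hp0 : 0 ≤ p := (criticalProb_mem_Icc _ _).1.trans hp.le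
  have hG : 2 * L + 1 + G ≤ blockR L 1 := by unfold blockR; omega
  exact ⟨⟨p, hp0, hp1.le⟩, hp,
    bondPercolation_real_pos_of_subset ⟨p, hp0, hp1.le⟩
      (blockEvent_subset_preimage_fattened L 1 G hG p ρ) hpos⟩

end Summit.CriticalPhenomena.PercolationContinuityZ3.Theorems

end
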